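import Mathlib
import Literature.Computability.AlgebraicComplexity.DeterminantalComplexity
import Literature.Computability.AlgebraicComplexity.LandsbergRessayreNormalForm
import Summits.ValiantsHypothesis.ValiantsHypothesis.Theorems.GrenetZeonTwoDimCoefficientsStubUnitDichotomy

/-!
# Crux `GrenetZeon.TwoDimCoefficients` (stmt-ValiantsHypothesis-8062), line `dim2_cases` —
# by-product: `dc(c·(per_n + K)²) ≥ n²/2`

The square pair `per_n = (1/4K)[(per_n + K)² − (per_n − K)²]` (this seat's
`GrenetZeonTwoDimCoefficientsSquareInstance.lean`, `UNIT-CASE-NOTE.md`) is the instance of the crux on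
which the Hessian-of-`det A` test is void (every zero of a square is a rank-`≤ 1` point of its
Hessian).  val-width-8062-p3's ISOTROPY theorem `sq_le_two_mul_of_det_eq_C_add_perPoly_mul`
(`GrenetZeonTwoDimCoefficientsStubUnitDichotomy.lean`, p580672: `det A = c + per_n·q`, `c ≠ 0`, `q ≠ 0`,
`n ≥ 3` ⇒ `n² ≤ 2m`, by a kernel plane of `A` at a singular point on which the zero-free `per_n` is
constant, hence totally isotropic for a non-degenerate `Hess per_n`) is blind to powers, so it settles
that instance: **every affine `m × m` matrix whose determinant is `c·(per_n + K)²` (`c, K ≠ 0`,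
`n ≥ 3`) has `n² ≤ 2m`** — a Mignon–Ressayre-strength lower bound for the SQUARE of the shifted
permanent (`sq_le_two_mul_of_hasDetRepr_sq_shift`), although Mignon–Ressayre's own argument says
nothing there.  Credit: the theorem doing the work is p3's; this file is the one-line instantiation.

HONEST FRAMING: a quadratic determinantal-complexity bound for one explicit VNP-ish polynomial; it
does not bear on `VP ≠ VNP`.

References: T. Mignon, N. Ressayre, Int. Math. Res. Not. 2004:79, Thm. 1.1; J. von zur Gathen,
*Permanent and determinant*, Linear Algebra Appl. 96 (1987) (linear subspaces in determinantal
hypersurfaces).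
-/

-- single-conjunct layout `Summits/ValiantsHypothesis/ValiantsHypothesis`: the duplicated namespace
-- component is mandated by the tree.
set_option linter.dupNamespace false

noncomputable section

namespace Summit.ValiantsHypothesis.ValiantsHypothesis.Cruxes.TwoDimCoefficients.DimTwoCases

open MvPolynomial Matrix
open Literature.Computability.AlgebraicComplexity

/-- **`dc(c·(per_n + K)²) ≥ n²/2`.**  If `c·(per_n + K)²` (`c, K ≠ 0`, `n ≥ 3`) is the determinant
of an `m × m` matrix of affine linear forms, then `n² ≤ 2m`. [folklore] -/
theorem sq_le_two_mul_of_hasDetRepr_sq_shift {n m : ℕ} (hn : 3 ≤ n) {c K : ℂ} (hc : c ≠ 0)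
    (hK : K ≠ 0) (h : HasDetRepr (C c * (perPoly (Fin n) ℂ + C K) ^ 2) m) : n ^ 2 ≤ 2 * m := by
  obtain ⟨k, rfl⟩ : ∃ k, n = k + 3 := ⟨n - 3, by omega⟩
  obtain ⟨A, hA, hdet⟩ := h
  have hdet' : A.det = C (c * K ^ 2) +
      perPoly (Fin (k + 3)) ℂ * (C (2 * c * K) + C c * perPoly (Fin (k + 3)) ℂ) := by
    rw [hdet, map_mul, map_pow, map_mul, map_mul, map_ofNat]
    ring
  refine sq_le_two_mul_of_det_eq_C_add_perPoly_mul A hA (mul_ne_zero hc (pow_ne_zero 2 hK)) ?_ hdet'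
  intro h0
  have h1 := congrArg constantCoeff h0
  rw [map_add, constantCoeff_C, map_mul, constantCoeff_C,
    constantCoeff_perPoly ℂ (show 1 ≤ k + 3 by omega), mul_zero, add_zero, map_zero] at h1
  exact mul_ne_zero (mul_ne_zero two_ne_zero hc) hK h1

/-- The same bound in `dc` form: `n² ≤ 2 · dc(c·(per_n + K)²)`. [folklore] -/
theorem sq_le_two_mul_determinantalComplexity_sq_shift {n : ℕ} (hn : 3 ≤ n) {c K : ℂ} (hc : c ≠ 0)
    (hK : K ≠ 0) :
    n ^ 2 ≤ 2 * determinantalComplexity (C c * (perPoly (Fin n) ℂ + C K) ^ 2) := by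
  have hne : {M : ℕ | HasDetRepr (C c * (perPoly (Fin n) ℂ + C K) ^ 2) M}.Nonempty :=
    exists_hasDetRepr_holds _
  exact sq_le_two_mul_of_hasDetRepr_sq_shift hn hc hK (Nat.sInf_mem hne)

end Summit.ValiantsHypothesis.ValiantsHypothesis.Cruxes.TwoDimCoefficients.DimTwoCases

end
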